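import Summits.AtomisticToContinuum.FouriersLaw.Theorems.LatticeLandauDampingAbelThermodynamicLimitOpenChainSeveredLocalityPathwise
import Summits.AtomisticToContinuum.FouriersLaw.Theorems.EmbeddedDrudeMourreAbelThermodynamicLimitFixedTimeOffsetMatchingProductForm

/-!
# Leaf (B₀) `stub_fixedTimeOffsetMatching` of S4, dynamic half, part 1: the pathwise open-chain / severed-box comparison
in CENTRED coordinates
(crux `EmbeddedDrudeMourre.AbelThermodynamicLimit`, item stmt-AtomisticToContinuum-12596, line
`loomis-compact-horizon-witness`; `--supports` file proving the registered sub-goal `stub_centredOpenSeveredPathwise`;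
closes nothing)

Deterministic core of the dynamic half `stub_centralWindowDynamicalMatching`. The open pinned chain
`X_s = chainFlow x η s` (momentum noise `η = chainNoise N c_L c_R w` of a pair of raw paths, acting on the two bath sites
only) is read on `ℤ` through the CENTRED embedding `ι_N` (site `l` at `l - c_N`, `c_N = ⌊(N-1)/2⌋`; entered through its
defining equation, part `…FixedTimeOffsetMatchingProductForm` §1) and compared with LLL's severed flow
`Y_s = T^{Λ_R}_s(ι_N x)` of the centred box `Λ_R = {-R, …, R}`, `2R + 4 ≤ N` (so `Λ_R` consists of interior non-bath
sites and its outer neighbours `±(R+1)` are chain sites). On `Λ_R` both curves solve the same nearest-neighbour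
Hamiltonian equations with the same initial data (§1); if the positions of both at the sites `|j| ≤ R+1` stay in
`[-ρ, ρ]` on `[0, t]`, the cubic forces are `Θ`-Lipschitz there (`Θ = ω₂ + 3 lam ρ² + 4(1 + 12βρ²)`, twin file
`…OpenChainSeveredLocalityPathwise`) and the second-order Dobrushin–Fritz iteration inward from the outer neighbours
gives at depth `d`, at every site `|i| ≤ R+1-d`, `|Δq_i(s)| ≤ 2ρ Θ^d s^{2d}/(2d)!`, `|Δp_i(s)| ≤ 2ρ Θ^d s^{2d-1}/(2d-1)!`
(§2, adapted from the twin line's `SeveredLocality.window_iteration`, itself from `OscillatorChain.df_iterate`,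
Buttà–Marchioro 2016 §3). §3: at the sites `x₀ ≤ i ≤ x₀+1` with depth `d = R - |x₀| ≥ 1`, in the regime
`2e√Θ t ≤ 2d - 1`, the bounds are `2ρ 2^{-2d}` and `2ρ√Θ 2^{-(2d-1)}` (`stub_centredOpenSeveredPathwise`).

All statements proved; `[folklore]`. No definitions.
-/

noncomputable section

namespace Summit.AtomisticToContinuum.FouriersLaw.Theorems.AbelThermodynamicLimit.LoomisCompactHorizonWitness

open MeasureTheory ProbabilityTheory Set Filter Topology Function
open scoped NNReal ENNReal
open Literature.MathematicalPhysics.KineticTheory Literature.MathematicalPhysics.KineticTheory.HeatConduction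
open Literature.Probability.Process OscillatorChain
open Summit.AtomisticToContinuum.FouriersLaw.Theorems.AbelThermodynamicLimit.SeriesLawAtEveryLaplaceFrequency.SeveredLocality
open Summit.AtomisticToContinuum.FouriersLaw.Theorems.NonBallistic.LightConePropagation
variable {N : ℕ} {ω₂ lam β γ : ℝ}

/-! ### §1 The open chain at an interior site, in centred coordinates -/

/-- **At an interior site the Langevin drift is the Hamiltonian force of the infinite chain, centred coordinates**:
for a chain site `m` with `m = k + c_N`, `0 < m`, `m + 1 < N`, `Y(z)_{p,m} = F_k(ι_N z)`. [folklore] -/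
theorem centred_drift_snd_eq_force (ω₂ lam β γ : ℝ) (ι : (N : ℕ) → PhaseSpace N → ChainConfig)
    (hι : ∀ (N : ℕ) (z : PhaseSpace N) (i : ℤ), ι N z i =
      if h : 0 ≤ i + ((N - 1) / 2 : ℕ) ∧ i + ((N - 1) / 2 : ℕ) < N then
        (z.1 ⟨(i + ((N - 1) / 2 : ℕ)).toNat, by omega⟩, z.2 ⟨(i + ((N - 1) / 2 : ℕ)).toNat, by omega⟩)
      else (0, 0)) (z : PhaseSpace N) (k : ℤ) (m : Fin N) (hm : (m : ℤ) = k + ((N - 1) / 2 : ℕ))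
    (h0 : 0 < m.val) (h1 : m.val + 1 < N) :
    ((pinnedChain ω₂ lam β γ).drift N z).2 m = (pinnedChain ω₂ lam β γ).force (ι N z) k := by
  -- adapted from `SeveredLocality.drift_snd_eq_force` (uncentred embedding)
  rw [pinnedChain_drift_apply]
  dsimp only
  have hw : bathWeight N m = 0 := by
    simp only [bathWeight]
    rw [if_neg (by omega), if_neg (by omega), add_zero]
  rw [hw, mul_zero, zero_mul, sub_zero, OscillatorChain.dPotential_eq_closed, dif_pos h0, dif_pos h1, force_eq]
  have e0 : (ι N z k).1 = z.1 m := by rw [centredEmbedding_apply_of_eq ι hι z k m hm]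
  have ep : (ι N z (k + 1)).1 = z.1 ⟨m.val + 1, h1⟩ := by
    rw [centredEmbedding_apply_of_eq ι hι z (k + 1) ⟨m.val + 1, h1⟩ (by push_cast; omega)]
  have em : (ι N z (k - 1)).1 = z.1 ⟨m.val - 1, by omega⟩ := by
    rw [centredEmbedding_apply_of_eq ι hι z (k - 1) ⟨m.val - 1, by omega⟩ (by
      have : ((m.val - 1 : ℕ) : ℤ) = (m.val : ℤ) - 1 := by omega
      rw [Fin.val_mk, this]; omega)]
  rw [e0, ep, em]
  ring

/-- **The open chain at an interior site, centred coordinates**: for a chain site `m = k + c_N` with `0 < m`,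
`m + 1 < N`, and `τ ≥ 0`, `q_k(τ) = q_k(0) + ∫₀^τ p_k` and `p_k(τ) = p_k(0) + ∫₀^τ F_k(ι_N X_s) ds`. [folklore] -/
theorem centred_chainFlow_interior_apply (hω : 0 < ω₂) (hl : 0 ≤ lam) (hβ : 0 ≤ β) (hγ : 0 ≤ γ)
    (ι : (N : ℕ) → PhaseSpace N → ChainConfig)
    (hι : ∀ (N : ℕ) (z : PhaseSpace N) (i : ℤ), ι N z i =
      if h : 0 ≤ i + ((N - 1) / 2 : ℕ) ∧ i + ((N - 1) / 2 : ℕ) < N then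
        (z.1 ⟨(i + ((N - 1) / 2 : ℕ)).toNat, by omega⟩, z.2 ⟨(i + ((N - 1) / 2 : ℕ)).toNat, by omega⟩)
      else (0, 0))
    (x : PhaseSpace N) (c_L c_R : ℝ) (w : WienerPair) (k : ℤ) (m : Fin N) (hm : (m : ℤ) = k + ((N - 1) / 2 : ℕ))
    (h0 : 0 < m.val) (h1 : m.val + 1 < N) {τ : ℝ} (hτ : 0 ≤ τ) :
    (ι N ((pinnedChain ω₂ lam β γ).chainFlow N x (chainNoise N c_L c_R w) τ) k).1 =
      (ι N x k).1 + ∫ s in (0:ℝ)..τ, (ι N ((pinnedChain ω₂ lam β γ).chainFlow N x (chainNoise N c_L c_R w) s) k).2 ∧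
    (ι N ((pinnedChain ω₂ lam β γ).chainFlow N x (chainNoise N c_L c_R w) τ) k).2 =
      (ι N x k).2 + ∫ s in (0:ℝ)..τ, (pinnedChain ω₂ lam β γ).force
        (ι N ((pinnedChain ω₂ lam β γ).chainFlow N x (chainNoise N c_L c_R w) s)) k := by
  -- adapted from `SeveredLocality.chainFlow_interior_apply`
  have hηc : Continuous (chainNoise N c_L c_R w) := continuous_chainNoise _ _ w
  have happ : ∀ y : PhaseSpace N, ι N y k = (y.1 m, y.2 m) := fun y => centredEmbedding_apply_of_eq ι hι y k m hm
  simp only [happ]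
  refine ⟨pinnedChain_chainFlow_fst_apply hω hl hβ hγ N x hηc m hτ, ?_⟩
  rw [pinnedChain_chainFlow_snd_apply hω hl hβ hγ N x hηc m hτ,
    chainNoise_apply_of_interior c_L c_R w τ m (by omega) (by omega), add_zero]
  congr 1
  refine intervalIntegral.integral_congr fun s _ => ?_
  exact centred_drift_snd_eq_force ω₂ lam β γ ι hι _ k m hm h0 h1

/-! ### §2 The Dobrushin–Fritz iteration, centred box -/

/-- **The Dobrushin–Fritz iteration for the open chain against the severed centred box** (integral form on
`[0, t]`; adapted from `SeveredLocality.window_iteration`). With `X_s = chainFlow x η s` (noise of a pair of raw paths),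
`Y_s = T^{Λ_R}_s(ι_N x)`, `Λ_R = {-R,…,R}`, `2R + 4 ≤ N`, and all positions of both curves at the sites `|j| ≤ R + 1` in
`[-ρ, ρ]` on `[0, t]`: for every `d` and every site `|i| ≤ R + 1 - d`, for `s ∈ [0, t]`,
`|q_i(X_s) - q_i(Y_s)| ≤ 2ρ Θ^d s^{2d}/(2d)!` and (for `d ≥ 1`) `|p_i(X_s) - p_i(Y_s)| ≤ 2ρ Θ^d s^{2d-1}/(2d-1)!`,
`Θ = ω₂ + 3 lam ρ² + 4(1 + 12βρ²)`. [folklore] -/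
theorem centred_window_iteration (hω : 0 < ω₂) (hl : 0 ≤ lam) (hβ : 0 ≤ β) (hγ : 0 ≤ γ)
    (hB1 : (pinnedChain ω₂ lam β γ).CondB1) (ι : (N : ℕ) → PhaseSpace N → ChainConfig)
    (hι : ∀ (N : ℕ) (z : PhaseSpace N) (i : ℤ), ι N z i =
      if h : 0 ≤ i + ((N - 1) / 2 : ℕ) ∧ i + ((N - 1) / 2 : ℕ) < N then
        (z.1 ⟨(i + ((N - 1) / 2 : ℕ)).toNat, by omega⟩, z.2 ⟨(i + ((N - 1) / 2 : ℕ)).toNat, by omega⟩)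
      else (0, 0))
    (x : PhaseSpace N) (c_L c_R : ℝ) (w : WienerPair) {R : ℕ} (hRN : 2 * R + 4 ≤ N) {ρ t : ℝ} (ht : 0 ≤ t)
    (hbox : ∀ s ∈ Icc (0:ℝ) t, ∀ j : ℤ, -((R : ℤ) + 1) ≤ j → j ≤ (R : ℤ) + 1 →
      |(ι N ((pinnedChain ω₂ lam β γ).chainFlow N x (chainNoise N c_L c_R w) s) j).1| ≤ ρ ∧
      |(severedFlow hB1 (Finset.Icc (-(R : ℤ)) R) s (ι N x) j).1| ≤ ρ) :
    ∀ (d : ℕ) (i : ℤ), -((R : ℤ) + 1) + d ≤ i → i ≤ (R : ℤ) + 1 - d → ∀ s ∈ Icc (0:ℝ) t,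
      |(ι N ((pinnedChain ω₂ lam β γ).chainFlow N x (chainNoise N c_L c_R w) s) i).1 -
          (severedFlow hB1 (Finset.Icc (-(R : ℤ)) R) s (ι N x) i).1| ≤
        2 * ρ * (ω₂ + 3 * lam * ρ ^ 2 + 4 * (1 + 12 * β * ρ ^ 2)) ^ d * s ^ (2 * d) / (2 * d).factorial ∧
      (1 ≤ d → |(ι N ((pinnedChain ω₂ lam β γ).chainFlow N x (chainNoise N c_L c_R w) s) i).2 -
          (severedFlow hB1 (Finset.Icc (-(R : ℤ)) R) s (ι N x) i).2| ≤
        2 * ρ * (ω₂ + 3 * lam * ρ ^ 2 + 4 * (1 + 12 * β * ρ ^ 2)) ^ d * s ^ (2 * d - 1) /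
          (2 * d - 1).factorial) := by
  -- adapted from `SeveredLocality.window_iteration` (uncentred embedding, window `[a, b]`)
  set P := pinnedChain ω₂ lam β γ with hP
  set η := chainNoise N c_L c_R w with hη
  set X : ℝ → PhaseSpace N := fun s => P.chainFlow N x η s with hX
  set Y : ℝ → ChainConfig := fun s => severedFlow hB1 (Finset.Icc (-(R : ℤ)) R) s (ι N x) with hY
  set Θ : ℝ := ω₂ + 3 * lam * ρ ^ 2 + 4 * (1 + 12 * β * ρ ^ 2) with hΘ
  have hιc : Continuous (ι N) := continuous_centredEmbedding ι hι N
  have hιXc : Continuous fun s => ι N (X s) :=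
    hιc.comp (pinnedChain_continuous_chainFlow hω hl hβ hγ N x (continuous_chainNoise _ _ w))
  have hYc : Continuous Y := continuous_severedFlow_curve hB1 _ (ι N x)
  have hρ : 0 ≤ ρ := (abs_nonneg _).trans (hbox 0 ⟨le_rfl, ht⟩ 0 (by omega) (by omega)).1
  have hΘ0 : 0 ≤ Θ := by positivity
  intro d
  induction d with
  | zero =>
    intro i hi1 hi2 s hs
    refine ⟨?_, fun h => absurd h (by norm_num)⟩
    obtain ⟨h1, h2⟩ := hbox s hs i (by omega) (by omega)
    rw [pow_zero, mul_one, mul_zero, pow_zero, mul_one, Nat.factorial_zero, Nat.cast_one, div_one]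
    calc |(ι N (X s) i).1 - (Y s i).1| ≤ |(ι N (X s) i).1| + |(Y s i).1| := abs_sub _ _
      _ ≤ ρ + ρ := add_le_add h1 h2
      _ = 2 * ρ := by ring
  | succ d ih =>
    intro i hi1 hi2
    push_cast at hi1 hi2
    have hiΛ : i ∈ Finset.Icc (-(R : ℤ)) R := by rw [Finset.mem_Icc]; omega
    have hi0 : 0 ≤ i + ((N - 1) / 2 : ℕ) := by omega
    set m : Fin N := ⟨(i + ((N - 1) / 2 : ℕ)).toNat, by omega⟩ with hm_def
    have hmi : (m : ℤ) = i + ((N - 1) / 2 : ℕ) := by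
      show (((i + ((N - 1) / 2 : ℕ)).toNat : ℕ) : ℤ) = i + ((N - 1) / 2 : ℕ)
      exact Int.toNat_of_nonneg hi0
    have hm0 : 0 < m.val := by
      have : (0 : ℤ) < (m : ℤ) := by rw [hmi]; omega
      exact_mod_cast this
    have hm1 : m.val + 1 < N := by
      have : (m : ℤ) + 1 < N := by rw [hmi]; omega
      exact_mod_cast this
    -- continuity of the integrands
    have hFc : Continuous fun r => P.force (ι N (X r)) i - P.force (Y r) i :=
      (continuous_force_comp ω₂ lam β γ hιXc i).sub (continuous_force_comp ω₂ lam β γ hYc i)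
    have hp2c : Continuous fun r => (ι N (X r) i).2 - (Y r i).2 :=
      (continuous_snd.comp ((continuous_apply i).comp hιXc)).sub
        (continuous_snd.comp ((continuous_apply i).comp hYc))
    -- the two differences as integrals (same initial data)
    have hDp_eq : ∀ s, 0 ≤ s → (ι N (X s) i).2 - (Y s i).2 =
        ∫ r in (0:ℝ)..s, (P.force (ι N (X r)) i - P.force (Y r) i) := by
      intro s hs
      obtain ⟨-, hX2⟩ := centred_chainFlow_interior_apply hω hl hβ hγ ι hι x c_L c_R w i m hmi hm0 hm1 hs
      obtain ⟨-, hY2⟩ := severedFlow_apply_integral ω₂ lam β γ hB1 (Finset.Icc (-(R : ℤ)) R) (ι N x) hiΛ s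
      rw [intervalIntegral.integral_sub ((continuous_force_comp ω₂ lam β γ hιXc i).intervalIntegrable _ _)
        ((continuous_force_comp ω₂ lam β γ hYc i).intervalIntegrable _ _)]
      show (ι N (P.chainFlow N x η s) i).2 - (severedFlow hB1 (Finset.Icc (-(R : ℤ)) R) s (ι N x) i).2 = _
      rw [hX2, hY2]
      ring
    have hDq_eq : ∀ s, 0 ≤ s → (ι N (X s) i).1 - (Y s i).1 =
        ∫ r in (0:ℝ)..s, ((ι N (X r) i).2 - (Y r i).2) := by
      intro s hs
      obtain ⟨hX1, -⟩ := centred_chainFlow_interior_apply hω hl hβ hγ ι hι x c_L c_R w i m hmi hm0 hm1 hs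
      obtain ⟨hY1, -⟩ := severedFlow_apply_integral ω₂ lam β γ hB1 (Finset.Icc (-(R : ℤ)) R) (ι N x) hiΛ s
      have i1 : IntervalIntegrable (fun r => (ι N (X r) i).2) volume 0 s :=
        (continuous_snd.comp ((continuous_apply i).comp hιXc)).intervalIntegrable _ _
      have i2 : IntervalIntegrable (fun r => (Y r i).2) volume 0 s :=
        (continuous_snd.comp ((continuous_apply i).comp hYc)).intervalIntegrable _ _
      rw [intervalIntegral.integral_sub i1 i2]
      show (ι N (P.chainFlow N x η s) i).1 - (severedFlow hB1 (Finset.Icc (-(R : ℤ)) R) s (ι N x) i).1 = _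
      rw [hX1, hY1]
      ring
    -- momenta
    have hDp : ∀ s ∈ Icc (0:ℝ) t, |(ι N (X s) i).2 - (Y s i).2| ≤
        2 * ρ * Θ ^ (d + 1) * s ^ (2 * d + 1) / (2 * d + 1).factorial := by
      intro s hs
      rw [hDp_eq s hs.1]
      have hbound : ∀ r ∈ Icc (0:ℝ) s, |P.force (ι N (X r)) i - P.force (Y r) i| ≤
          Θ * (2 * ρ * Θ ^ d * r ^ (2 * d) / (2 * d).factorial) := by
        intro r hr
        have hrt : r ∈ Icc (0:ℝ) t := ⟨hr.1, hr.2.trans hs.2⟩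
        exact abs_force_sub_le hω.le hl hβ γ (fun j hj1 hj2 => hbox r hrt j (by omega) (by omega))
          (fun j hj1 hj2 => (ih j (by omega) (by omega) r hrt).1)
      have hbc : Continuous fun r : ℝ => Θ * (2 * ρ * Θ ^ d * r ^ (2 * d) / (2 * d).factorial) := by fun_prop
      calc |∫ r in (0:ℝ)..s, (P.force (ι N (X r)) i - P.force (Y r) i)|
          ≤ ∫ r in (0:ℝ)..s, |P.force (ι N (X r)) i - P.force (Y r) i| :=
            intervalIntegral.abs_integral_le_integral_abs hs.1
        _ ≤ ∫ r in (0:ℝ)..s, Θ * (2 * ρ * Θ ^ d * r ^ (2 * d) / (2 * d).factorial) :=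
            intervalIntegral.integral_mono_on hs.1 (hFc.abs.intervalIntegrable _ _) (hbc.intervalIntegrable _ _)
              hbound
        _ = ∫ r in (0:ℝ)..s, (Θ * (2 * ρ * Θ ^ d) / (2 * d).factorial) * r ^ (2 * d) :=
            intervalIntegral.integral_congr fun r _ => by ring
        _ = 2 * ρ * Θ ^ (d + 1) * s ^ (2 * d + 1) / (2 * d + 1).factorial := by
            rw [integral_const_mul_pow, Nat.factorial_succ (2 * d)]
            push_cast
            have hf : ((2 * d).factorial : ℝ) ≠ 0 := by positivity
            field_simp
            ring
    intro s hs
    refine ⟨?_, fun _ => ?_⟩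
    · rw [hDq_eq s hs.1]
      have hbc : Continuous fun r : ℝ => 2 * ρ * Θ ^ (d + 1) * r ^ (2 * d + 1) / (2 * d + 1).factorial := by
        fun_prop
      calc |∫ r in (0:ℝ)..s, ((ι N (X r) i).2 - (Y r i).2)|
          ≤ ∫ r in (0:ℝ)..s, |(ι N (X r) i).2 - (Y r i).2| := intervalIntegral.abs_integral_le_integral_abs hs.1
        _ ≤ ∫ r in (0:ℝ)..s, 2 * ρ * Θ ^ (d + 1) * r ^ (2 * d + 1) / (2 * d + 1).factorial :=
            intervalIntegral.integral_mono_on hs.1 (hp2c.abs.intervalIntegrable _ _) (hbc.intervalIntegrable _ _)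
              fun r hr => hDp r ⟨hr.1, hr.2.trans hs.2⟩
        _ = ∫ r in (0:ℝ)..s, (2 * ρ * Θ ^ (d + 1) / (2 * d + 1).factorial) * r ^ (2 * d + 1) :=
            intervalIntegral.integral_congr fun r _ => by ring
        _ = 2 * ρ * Θ ^ (d + 1) * s ^ (2 * (d + 1)) / (2 * (d + 1)).factorial := by
            rw [integral_const_mul_pow, show 2 * (d + 1) = (2 * d + 1) + 1 by ring, Nat.factorial_succ (2 * d + 1)]
            push_cast
            have hf : ((2 * d + 1).factorial : ℝ) ≠ 0 := by positivity
            field_simp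
    · rw [show 2 * (d + 1) - 1 = 2 * d + 1 by omega]
      exact hDp s hs


/-! ### §3 The pathwise core near the observed bond -/

/-- **The pathwise core at the observed bond `(x₀, x₀+1)`, centred coordinates.** In the setting of
`centred_window_iteration`, with depth `d = R - |x₀| ≥ 1` and in the regime `2e √Θ t ≤ 2d - 1`: at the sites
`x₀ ≤ i ≤ x₀ + 1` and at time `t`, `|Δq_i| ≤ 2ρ (1/2)^{2d}` and `|Δp_i| ≤ 2ρ √Θ (1/2)^{2d-1}` (`c^m/m! ≤ 2^{-m}` once
`2ec ≤ m`; adapted from the twin line's `SeveredLocality.central_bond_estimate`). [folklore] -/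
theorem centred_core_estimate (hω : 0 < ω₂) (hl : 0 ≤ lam) (hβ : 0 ≤ β) (hγ : 0 ≤ γ)
    (hB1 : (pinnedChain ω₂ lam β γ).CondB1) (ι : (N : ℕ) → PhaseSpace N → ChainConfig)
    (hι : ∀ (N : ℕ) (z : PhaseSpace N) (i : ℤ), ι N z i =
      if h : 0 ≤ i + ((N - 1) / 2 : ℕ) ∧ i + ((N - 1) / 2 : ℕ) < N then
        (z.1 ⟨(i + ((N - 1) / 2 : ℕ)).toNat, by omega⟩, z.2 ⟨(i + ((N - 1) / 2 : ℕ)).toNat, by omega⟩)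
      else (0, 0))
    (x : PhaseSpace N) (c_L c_R : ℝ) (w : WienerPair) {R : ℕ} (hRN : 2 * R + 4 ≤ N) {ρ t : ℝ} (ht : 0 ≤ t)
    (hbox : ∀ s ∈ Icc (0:ℝ) t, ∀ j : ℤ, -((R : ℤ) + 1) ≤ j → j ≤ (R : ℤ) + 1 →
      |(ι N ((pinnedChain ω₂ lam β γ).chainFlow N x (chainNoise N c_L c_R w) s) j).1| ≤ ρ ∧
      |(severedFlow hB1 (Finset.Icc (-(R : ℤ)) R) s (ι N x) j).1| ≤ ρ)
    (x₀ : ℤ) (hx : x₀.natAbs + 1 ≤ R)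
    (hreg : 2 * Real.exp 1 * (Real.sqrt (ω₂ + 3 * lam * ρ ^ 2 + 4 * (1 + 12 * β * ρ ^ 2)) * t) ≤
      2 * ((R : ℝ) - x₀.natAbs) - 1)
    (i : ℤ) (hi1 : x₀ ≤ i) (hi2 : i ≤ x₀ + 1) :
    |(ι N ((pinnedChain ω₂ lam β γ).chainFlow N x (chainNoise N c_L c_R w) t) i).1 -
        (severedFlow hB1 (Finset.Icc (-(R : ℤ)) R) t (ι N x) i).1| ≤ 2 * ρ * (1 / 2) ^ (2 * (R - x₀.natAbs)) ∧
    |(ι N ((pinnedChain ω₂ lam β γ).chainFlow N x (chainNoise N c_L c_R w) t) i).2 -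
        (severedFlow hB1 (Finset.Icc (-(R : ℤ)) R) t (ι N x) i).2| ≤
      2 * ρ * Real.sqrt (ω₂ + 3 * lam * ρ ^ 2 + 4 * (1 + 12 * β * ρ ^ 2)) * (1 / 2) ^ (2 * (R - x₀.natAbs) - 1) := by
  -- adapted from `SeveredLocality.central_bond_estimate`
  set Θ : ℝ := ω₂ + 3 * lam * ρ ^ 2 + 4 * (1 + 12 * β * ρ ^ 2) with hΘ
  set d : ℕ := R - x₀.natAbs with hd
  have hd1 : 1 ≤ d := by omega
  have hρ : 0 ≤ ρ := (abs_nonneg _).trans (hbox 0 ⟨le_rfl, ht⟩ 0 (by omega) (by omega)).1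
  have hΘ0 : 0 ≤ Θ := by positivity
  have hit := centred_window_iteration hω hl hβ hγ hB1 ι hι x c_L c_R w hRN ht hbox d i
    (by omega) (by omega) t ⟨ht, le_rfl⟩
  rw [← hΘ] at hit
  obtain ⟨hq, hp⟩ := hit
  have hp := hp hd1
  set c : ℝ := Real.sqrt Θ * t with hc
  have hc0 : 0 ≤ c := mul_nonneg (Real.sqrt_nonneg _) ht
  have hsq : Real.sqrt Θ ^ 2 = Θ := Real.sq_sqrt hΘ0
  have e1 : Θ ^ d * t ^ (2 * d) = c ^ (2 * d) := by
    calc Θ ^ d * t ^ (2 * d) = (Real.sqrt Θ ^ 2) ^ d * t ^ (2 * d) := by rw [hsq]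
      _ = c ^ (2 * d) := by rw [hc, ← pow_mul, mul_pow]
  obtain ⟨d', hd'⟩ : ∃ d', d = d' + 1 := ⟨d - 1, by omega⟩
  have e2 : Θ ^ d * t ^ (2 * d - 1) = Real.sqrt Θ * c ^ (2 * d - 1) := by
    rw [hd', show 2 * (d' + 1) - 1 = 2 * d' + 1 by omega]
    calc Θ ^ (d' + 1) * t ^ (2 * d' + 1) = (Real.sqrt Θ ^ 2) ^ (d' + 1) * t ^ (2 * d' + 1) := by rw [hsq]
      _ = Real.sqrt Θ * c ^ (2 * d' + 1) := by rw [hc, ← pow_mul, mul_pow]; ring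
  have hdR : ((d : ℕ) : ℝ) = (R : ℝ) - x₀.natAbs := by
    rw [hd]; push_cast [Nat.cast_sub (by omega : x₀.natAbs ≤ R)]; ring
  have hreg2 : 2 * Real.exp 1 * c ≤ ((2 * d : ℕ) : ℝ) := by push_cast; rw [hdR]; linarith
  have hreg1 : 2 * Real.exp 1 * c ≤ ((2 * d - 1 : ℕ) : ℝ) := by
    rw [Nat.cast_sub (by omega : 1 ≤ 2 * d)]; push_cast; rw [hdR]; linarith
  have k1 := BMLightCone.pow_div_factorial_le_half_pow hc0 (m := 2 * d) (by omega) hreg2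
  have k2 := BMLightCone.pow_div_factorial_le_half_pow hc0 (m := 2 * d - 1) (by omega) hreg1
  constructor
  · calc _ ≤ 2 * ρ * Θ ^ d * t ^ (2 * d) / ((2 * d).factorial : ℝ) := hq
      _ = 2 * ρ * (c ^ (2 * d) / ((2 * d).factorial : ℝ)) := by rw [mul_assoc (2 * ρ), e1]; ring
      _ ≤ 2 * ρ * (1 / 2) ^ (2 * d) := mul_le_mul_of_nonneg_left k1 (by positivity)
  · calc _ ≤ 2 * ρ * Θ ^ d * t ^ (2 * d - 1) / ((2 * d - 1).factorial : ℝ) := hp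
      _ = 2 * ρ * Real.sqrt Θ * (c ^ (2 * d - 1) / ((2 * d - 1).factorial : ℝ)) := by
          rw [mul_assoc (2 * ρ), e2]; ring
      _ ≤ 2 * ρ * Real.sqrt Θ * (1 / 2) ^ (2 * d - 1) := mul_le_mul_of_nonneg_left k2 (by positivity)




/-- **Registered sub-goal `stub_centredOpenSeveredPathwise`** (dynamic half of leaf (B₀), line `loomis-compact-horizon-witness`):
the pathwise core in centred coordinates (`centred_core_estimate`, closed form). [folklore] -/
theorem stub_centredOpenSeveredPathwise :
    ∀ ω₂ lam β γ : ℝ, 0 < ω₂ → 0 ≤ lam → 0 ≤ β → 0 ≤ γ →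
      ∀ (hB1 : (Literature.MathematicalPhysics.KineticTheory.HeatConduction.pinnedChain ω₂ lam β γ).CondB1),
      ∀ (ι : (N : ℕ) → Literature.MathematicalPhysics.KineticTheory.HeatConduction.PhaseSpace N → Literature.MathematicalPhysics.KineticTheory.HeatConduction.ChainConfig),
        (∀ (N : ℕ) (z : Literature.MathematicalPhysics.KineticTheory.HeatConduction.PhaseSpace N) (i : ℤ),
          ι N z i = if h : 0 ≤ i + ((N - 1) / 2 : ℕ) ∧ i + ((N - 1) / 2 : ℕ) < N then
            (z.1 ⟨(i + ((N - 1) / 2 : ℕ)).toNat, by omega⟩, z.2 ⟨(i + ((N - 1) / 2 : ℕ)).toNat, by omega⟩)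
            else (0, 0)) →
      ∀ (N : ℕ) (x : Literature.MathematicalPhysics.KineticTheory.HeatConduction.PhaseSpace N) (c_L c_R : ℝ) (w : Literature.Probability.Process.WienerPair) (R : ℕ), 2 * R + 4 ≤ N →
      ∀ (ρ t : ℝ), 0 ≤ t →
        (∀ s ∈ Set.Icc (0:ℝ) t, ∀ j : ℤ, -((R : ℤ) + 1) ≤ j → j ≤ (R : ℤ) + 1 →
          |(ι N ((Literature.MathematicalPhysics.KineticTheory.HeatConduction.pinnedChain ω₂ lam β γ).chainFlow N x (Literature.MathematicalPhysics.KineticTheory.HeatConduction.chainNoise N c_L c_R w) s) j).1| ≤ ρ ∧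
          |(Literature.MathematicalPhysics.KineticTheory.HeatConduction.OscillatorChain.severedFlow hB1 (Finset.Icc (-(R : ℤ)) R) s (ι N x) j).1| ≤ ρ) →
      ∀ (x₀ : ℤ), x₀.natAbs + 1 ≤ R →
        2 * Real.exp 1 * (Real.sqrt (ω₂ + 3 * lam * ρ ^ 2 + 4 * (1 + 12 * β * ρ ^ 2)) * t) ≤
          2 * ((R : ℝ) - x₀.natAbs) - 1 →
      ∀ (i : ℤ), x₀ ≤ i → i ≤ x₀ + 1 →
        |(ι N ((Literature.MathematicalPhysics.KineticTheory.HeatConduction.pinnedChain ω₂ lam β γ).chainFlow N x (Literature.MathematicalPhysics.KineticTheory.HeatConduction.chainNoise N c_L c_R w) t) i).1 -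
            (Literature.MathematicalPhysics.KineticTheory.HeatConduction.OscillatorChain.severedFlow hB1 (Finset.Icc (-(R : ℤ)) R) t (ι N x) i).1| ≤
          2 * ρ * (1 / 2) ^ (2 * (R - x₀.natAbs)) ∧
        |(ι N ((Literature.MathematicalPhysics.KineticTheory.HeatConduction.pinnedChain ω₂ lam β γ).chainFlow N x (Literature.MathematicalPhysics.KineticTheory.HeatConduction.chainNoise N c_L c_R w) t) i).2 -
            (Literature.MathematicalPhysics.KineticTheory.HeatConduction.OscillatorChain.severedFlow hB1 (Finset.Icc (-(R : ℤ)) R) t (ι N x) i).2| ≤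
          2 * ρ * Real.sqrt (ω₂ + 3 * lam * ρ ^ 2 + 4 * (1 + 12 * β * ρ ^ 2)) * (1 / 2) ^ (2 * (R - x₀.natAbs) - 1) :=
  fun _ _ _ _ hω hl hβ hγ hB1 ι hι _ x c_L c_R w _ hRN _ _ ht hbox x₀ hx hreg i hi1 hi2 =>
    centred_core_estimate hω hl hβ hγ hB1 ι hι x c_L c_R w hRN ht hbox x₀ hx hreg i hi1 hi2

end Summit.AtomisticToContinuum.FouriersLaw.Theorems.AbelThermodynamicLimit.LoomisCompactHorizonWitness

end
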